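import Literature.Computability.MetaComplexity.SmolenskyParity
import HarnessLib

/-!
# Smolensky's method for MAJORITY and the natural property in characteristic `2`

Continuation of `SmolenskyProperty.lean`, `SmolenskyDimensionBound.lean`, `SmolenskyParity.lean`
(groundwork for the named fact `Literature.Computability.Learning.cikk_learn_AC0Mod`, CIKK 2016
Cor. 5.4, via CIKK Thm. 5.3). The property of those files, `dim(f̄L + L) ≥ (3/4)2ⁿ` with the
`±1`-version `f̄ = 1 - 2h`, is EMPTY over fields of characteristic `2` (there `f̄ = 1`), so it
cannot serve the prime `p = 2`, for which CIKK quote Razborov's rank property instead. This file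
observes that the `0/1`-version of the same property serves EVERY prime, and proves everything the
learning application needs about it, debt-free:

* `indOf`, `ispace h = gL + L` (`g = [h = 1]`), `iproperty F` ("`dim(gL + L) ≥ (3/4)2ⁿ`");
  `space_le_ispace`, and `ispace_eq_space` / `iproperty_eq_property` when `2 ≠ 0` (so nothing
  changes for odd `p`);
* **`L + MAJ·L = everything`** for odd `n` over ANY field (`ispace_majorityFn_eq_top`): the lower
  half `{|x| ≤ (n-1)/2}` and the upper half of the cube are interpolation sets for the polynomials
  of degree `≤ (n-1)/2` (`exists_lowDeg_eq_on_lower`, `exists_lowDeg_eq_on_upper`; truncated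
  inclusion–exclusion and the complement symmetry `x ↦ ¬x`, under which `lowDeg` is stable,
  `funLeft_bnot_mem_lowDeg`); hence `dim L ≥ 2ⁿ⁻¹` in every characteristic
  (`two_pow_le_two_mul_finrank_lowDeg'`) and MAJORITY has the property maximally
  (`majorityFn_mem_iproperty`);
* **largeness in characteristic `2`** by the pairing `h ↦ h ⊕ MAJ` (`three_mul_two_pow_le_of_two_eq_zero`,
  using that `h ↦ [h]` is additive modulo `2`), whence, together with the parity pairing of
  `SmolenskyProperty.lean`, largeness `≥ 1/2` over EVERY field for odd `n`
  (`two_pow_le_two_mul_card_iproperty`);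
* the dimension bound and usefulness for the `0/1`-version (`finrank_ispace_le`,
  `not_mem_iproperty`, `not_mem_iproperty_of_computes` — all primes `p`, including `2`);
* **MAJORITY ∉ AC⁰[p] for every prime `p`, quantitatively** (`smolensky_majority`): a depth-`d`
  circuit over `{¬, ∧, ∨, MOD_p}` computing the majority of an odd number `n` of bits has size
  `≥ p^ℓ/8` whenever `64((p-1)ℓ)^{2d} ≤ n`, i.e. size `2^{Ω(n^{1/(2d)})}` — Razborov 1987 for
  `p = 2`, Smolensky 1987 (Thm. 2 and its Corollary: "When `p = 2` this gives Razborov's new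
  result") in general; textbook form Jukna 2012, Thm. 12.24.

## References

* A. A. Razborov, *Lower bounds on the size of bounded depth circuits over a complete basis with
  logical addition*, Math. Notes 41 (1987) 333–338 [Razborov1987].
* R. Smolensky, *Algebraic methods in the theory of lower bounds for Boolean circuit complexity*,
  STOC 1987, 77–82, Thm. 2 and Corollary (p. 80) [Smolensky1987].
* S. Jukna, *Boolean Function Complexity*, Springer 2012, §12.5, Lemma 12.22 and Thm. 12.24
  [Jukna2012].
* M. Carmosino, R. Impagliazzo, V. Kabanets, A. Kolokolova, *Learning algorithms from natural
  proofs*, CCC 2016, LIPIcs 50, Thm. 5.3, §5.2 [CarmosinoImpagliazzoKabanetsKolokolova2016].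

## Design notes

* The interpolation argument is the "voting polynomials" mechanism (a nonzero multilinear
  polynomial of degree `≤ (n-1)/2` cannot vanish on a whole half of the cube); it replaces, for
  MAJORITY, the character trick `ḡL = H` used for PARITY, and works in characteristic `2` as well.
* No named facts are introduced (D-0026): every statement below is proved.
-/

namespace Literature.Computability.MetaComplexity

open Finset Module Literature.Computability.Complexity

namespace Smolensky

variable {F : Type*} [Field F] {n : ℕ}

/-! ### The `0/1` version of Smolensky's space and property -/

/-- The `0/1` indicator `g = [h = 1]` of a Boolean function `h`, as an `F`-valued function on the
cube. [folklore] -/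
def indOf (F : Type*) [Field F] {n : ℕ} (h : (Fin n → Bool) → Bool) : CubeFn F n :=
  fun b => if h b then 1 else 0

/-- Unfolding `indOf`. [folklore] -/
@[simp] theorem indOf_apply (h : (Fin n → Bool) → Bool) (b : Fin n → Bool) :
    indOf F h b = if h b then 1 else 0 := rfl

/-- The **`0/1` version of Smolensky's space**: `gL + L` with `g = [h = 1]` and
`L = lowDeg F n (n/2)`. [cite: CarmosinoImpagliazzoKabanetsKolokolova2016, Thm. 5.3 (§5.2)] -/
def ispace (F : Type*) [Field F] {n : ℕ} (h : (Fin n → Bool) → Bool) : Submodule F (CubeFn F n) :=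
  (lowDeg F n (n / 2)).map (LinearMap.mulLeft F (indOf F h)) ⊔ lowDeg F n (n / 2)

/-- The **`0/1` version of Smolensky's natural property**: "accept `h` iff
`dim(gL + L) ≥ (3/4)·2ⁿ`", in `ℕ` as `3·2ⁿ ≤ 4·dim`. Over fields with `2 ≠ 0` it IS the printed
property (`iproperty_eq_property`); over `GF(2)` it is the variant this file shows to be natural and
useful against `AC⁰[2]`. [cite: CarmosinoImpagliazzoKabanetsKolokolova2016, Thm. 5.3 (§5.2)] -/
def iproperty (F : Type*) [Field F] : CombinatorialProperty := fun n =>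
  {h | 3 * 2 ^ n ≤ 4 * Module.finrank F (ispace F (n := n) h)}

/-- Membership in the `0/1` property (definitional). [folklore] -/
theorem mem_iproperty_iff (h : (Fin n → Bool) → Bool) :
    h ∈ iproperty F n ↔ 3 * 2 ^ n ≤ 4 * Module.finrank F (ispace F h) :=
  Iff.rfl

/-- `f̄L + L ⊆ gL + L` always: `f̄ q = q - 2(g q)`. [folklore] -/
theorem space_le_ispace (h : (Fin n → Bool) → Bool) : space F h ≤ ispace F h := by
  refine sup_le ?_ le_sup_right
  intro x hx
  obtain ⟨q, hq, rfl⟩ := Submodule.mem_map.1 hx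
  have hrw : (LinearMap.mulLeft F (pmOf F h)) q =
      q - (2 : F) • (LinearMap.mulLeft F (indOf F h)) q := by
    funext b
    simp only [LinearMap.mulLeft_apply, Pi.mul_apply, Pi.sub_apply, Pi.smul_apply, smul_eq_mul,
      pmOf, indOf_apply]
    split <;> ring
  rw [hrw]
  exact Submodule.sub_mem _ (Submodule.mem_sup_right hq)
    (Submodule.smul_mem _ _ (Submodule.mem_sup_left (Submodule.mem_map_of_mem hq)))

/-- When `2 ≠ 0` in `F`, `gL + L ⊆ f̄L + L` too: `g q = 2⁻¹(q - f̄ q)`. [folklore] -/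
theorem ispace_le_space (h2 : (2 : F) ≠ 0) (h : (Fin n → Bool) → Bool) :
    ispace F h ≤ space F h := by
  refine sup_le ?_ le_sup_right
  intro x hx
  obtain ⟨q, hq, rfl⟩ := Submodule.mem_map.1 hx
  have hrw : (LinearMap.mulLeft F (indOf F h)) q =
      (2 : F)⁻¹ • (q - (LinearMap.mulLeft F (pmOf F h)) q) := by
    funext b
    simp only [LinearMap.mulLeft_apply, Pi.mul_apply, Pi.sub_apply, Pi.smul_apply, smul_eq_mul,
      pmOf, indOf_apply]
    split
    · rw [neg_one_mul, sub_neg_eq_add, ← two_mul, ← mul_assoc, inv_mul_cancel₀ h2, one_mul]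
    · rw [one_mul, sub_self, mul_zero, zero_mul]
  rw [hrw]
  exact Submodule.smul_mem _ _ (Submodule.sub_mem _ (Submodule.mem_sup_right hq)
    (Submodule.mem_sup_left (Submodule.mem_map_of_mem hq)))

/-- For `2 ≠ 0` the two spaces coincide: `gL + L = f̄L + L`. [folklore] -/
theorem ispace_eq_space (h2 : (2 : F) ≠ 0) (h : (Fin n → Bool) → Bool) :
    ispace F h = space F h :=
  le_antisymm (ispace_le_space h2 h) (space_le_ispace h)

/-- For `2 ≠ 0` the `0/1` property IS Smolensky's printed property. [folklore] -/
theorem iproperty_eq_property (h2 : (2 : F) ≠ 0) : iproperty F = property F := by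
  funext n
  ext h
  rw [mem_iproperty_iff, mem_property_iff, ispace_eq_space h2]

/-! ### The majority function -/

/-- The majority function on `n` bits: `true` iff at least half of the inputs are `true`
(`n ≤ 2·#ones`; for odd `n`: more ones than zeros). [cite: Jukna2012, §12.5 (Maj_n)] -/
def majorityFn (n : ℕ) (b : Fin n → Bool) : Bool := decide (n ≤ 2 * GateFn.numOnes b)

/-- `majorityFn n` is the truth table of the majority gate `MAJₙ`. [folklore] -/
theorem majorityFn_eq_maj (n : ℕ) : majorityFn n = (GateFn.maj n).2 := rfl

/-- A monomial of degree `> |b|` vanishes at `b`. [folklore] -/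
theorem mono_apply_eq_zero_of_lt (S : Finset (Fin n)) (b : Fin n → Bool)
    (hb : GateFn.numOnes b < S.card) : mono F S b = 0 := by
  rw [mono_apply, if_neg]
  intro hall
  refine absurd hb (not_lt.2 ?_)
  unfold GateFn.numOnes
  exact Finset.card_le_card fun i hi => by simpa using hall i hi

/-! ### Interpolation on the lower half of the cube -/

/-- **Truncated inclusion–exclusion**: for every point `a` and every `m` there is a polynomial of
degree `≤ m` that agrees with the indicator `δ_a` at all points of weight `≤ m` (drop from the
expansion of `δ_a` the monomials of degree `> m`, which vanish there). [folklore] -/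
theorem exists_lowDeg_indicator_lower (m : ℕ) (a : Fin n → Bool) :
    ∃ q ∈ lowDeg F n m, ∀ b : Fin n → Bool, GateFn.numOnes b ≤ m →
      q b = if b = a then (1 : F) else 0 := by
  classical
  set A : Finset (Fin n) := univ.filter fun i => a i = true with hA
  set Ac : Finset (Fin n) := univ.filter fun i => a i = false with hAc
  refine ⟨∑ T ∈ Ac.powerset.filter (fun T => (A ∪ T).card ≤ m),
      ((-1 : F) ^ T.card) • mono F (A ∪ T), ?_, fun b hb => ?_⟩
  · refine Submodule.sum_mem _ fun T hT => Submodule.smul_mem _ _ (mono_mem_lowDeg ?_)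
    exact (Finset.mem_filter.1 hT).2
  · have hfull : (if b = a then (1 : F) else 0) =
        (∑ T ∈ Ac.powerset, ((-1 : F) ^ T.card) • mono F (A ∪ T)) b :=
      congrFun (indicator_eq_sum (F := F) a) b
    rw [hfull, ← Finset.sum_filter_add_sum_filter_not Ac.powerset (fun T => (A ∪ T).card ≤ m)]
    simp only [Finset.sum_apply, Pi.add_apply, Pi.smul_apply, smul_eq_mul]
    have hzero : ∑ T ∈ Ac.powerset.filter (fun T => ¬(A ∪ T).card ≤ m),
        (-1 : F) ^ T.card * mono F (A ∪ T) b = 0 := by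
      refine Finset.sum_eq_zero fun T hT => ?_
      have hT' := (Finset.mem_filter.1 hT).2
      rw [mono_apply_eq_zero_of_lt _ _ (by omega), mul_zero]
    rw [hzero, add_zero]

/-- **The lower half of the cube is an interpolation set for degree `≤ m`**: every function agrees
on `{b : |b| ≤ m}` with some polynomial of degree `≤ m`. [folklore] -/
theorem exists_lowDeg_eq_on_lower (m : ℕ) (v : CubeFn F n) :
    ∃ q ∈ lowDeg F n m, ∀ b : Fin n → Bool, GateFn.numOnes b ≤ m → q b = v b := by
  classical
  choose q hq hqv using fun a : Fin n → Bool => exists_lowDeg_indicator_lower (F := F) m a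
  refine ⟨∑ a, v a • q a, Submodule.sum_mem _ fun a _ => Submodule.smul_mem _ _ (hq a),
    fun b hb => ?_⟩
  rw [Finset.sum_apply]
  simp only [Pi.smul_apply, smul_eq_mul]
  calc ∑ a, v a * q a b = ∑ a, (if b = a then v a else 0) := by
        refine Finset.sum_congr rfl fun a _ => ?_
        rw [hqv a b hb]
        split <;> simp
    _ = v b := by rw [Finset.sum_ite_eq]; simp

/-! ### The complement symmetry and the upper half -/

/-- Bitwise complement of a point of the cube. [folklore] -/
def bnot (b : Fin n → Bool) : Fin n → Bool := fun i => !b i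

/-- The complement is an involution. [folklore] -/
@[simp] theorem bnot_bnot (b : Fin n → Bool) : bnot (bnot b) = b := by
  funext i; simp [bnot]

/-- The complement exchanges the weights: `|¬b| = n - |b|`. [folklore] -/
theorem numOnes_bnot (b : Fin n → Bool) : GateFn.numOnes (bnot b) = n - GateFn.numOnes b := by
  unfold GateFn.numOnes
  have h := Finset.card_filter_add_card_filter_not (s := (univ : Finset (Fin n)))
    (p := fun i => b i = true)
  rw [Finset.card_univ, Fintype.card_fin] at h
  have h2 : (univ.filter fun i => bnot b i = true) = univ.filter fun i => ¬b i = true := by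
    ext i; simp [bnot]
  rw [h2]
  omega

/-- **`lowDeg` is stable under the complement substitution `xᵢ ↦ 1 - xᵢ`**: for `u` of degree
`≤ D`, `b ↦ u(¬b)` has degree `≤ D` (expand `Π_{i ∈ S}(1 - xᵢ)`). [folklore] -/
theorem funLeft_bnot_mem_lowDeg {D : ℕ} {u : CubeFn F n} (hu : u ∈ lowDeg F n D) :
    LinearMap.funLeft F F bnot u ∈ lowDeg F n D := by
  classical
  have hle : (lowDeg F n D).map (LinearMap.funLeft F F (bnot (n := n))) ≤ lowDeg F n D := by
    rw [lowDeg_eq_span (D := D), Submodule.map_span_le]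
    rintro _ ⟨⟨S, hS⟩, rfl⟩
    dsimp only
    -- `x_S(¬b) = Π_{i∈S} (1 - xᵢ(b)) = Σ_{T ⊆ S} (-1)^{|T|} x_T(b)`
    have hexp : LinearMap.funLeft F F bnot (mono F S) =
        ∑ T ∈ S.powerset, ((-1 : F) ^ T.card) • mono F T := by
      funext b
      rw [LinearMap.funLeft_apply, Finset.sum_apply]
      simp only [Pi.smul_apply, smul_eq_mul, mono]
      have h1 : ∀ i ∈ S, (if bnot b i = true then (1 : F) else 0) =
          1 + -(if b i = true then (1 : F) else 0) := by
        intro i _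
        simp only [bnot]
        rcases Bool.eq_false_or_eq_true (b i) with hb | hb <;> simp [hb]
      rw [Finset.prod_congr rfl h1, Finset.prod_one_add]
      refine Finset.sum_congr rfl fun T _ => ?_
      rw [Finset.prod_neg]
    rw [hexp]
    refine Submodule.sum_mem _ fun T hT => Submodule.smul_mem _ _ (mono_mem_lowDeg ?_)
    exact (Finset.card_le_card (Finset.mem_powerset.1 hT)).trans hS
  exact hle (Submodule.mem_map_of_mem hu)

/-- **The upper half is an interpolation set too** (odd `n = 2m+1`): every function agrees on
`{b : |b| ≥ m+1}` with some polynomial of degree `≤ m` (reflect through `b ↦ ¬b`). [folklore] -/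
theorem exists_lowDeg_eq_on_upper {m : ℕ} (hn : n = 2 * m + 1) (v : CubeFn F n) :
    ∃ q ∈ lowDeg F n m, ∀ b : Fin n → Bool, m + 1 ≤ GateFn.numOnes b → q b = v b := by
  obtain ⟨q, hq, hqv⟩ := exists_lowDeg_eq_on_lower (F := F) m (LinearMap.funLeft F F bnot v)
  refine ⟨LinearMap.funLeft F F bnot q, funLeft_bnot_mem_lowDeg hq, fun b hb => ?_⟩
  have hw : GateFn.numOnes (bnot b) ≤ m := by
    rw [numOnes_bnot]
    omega
  have := hqv (bnot b) hw
  rw [LinearMap.funLeft_apply] at this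
  rw [LinearMap.funLeft_apply, this, bnot_bnot]

/-! ### `L + MAJ·L` is everything -/

/-- **`L + MAJ·L = everything`** for odd `n`, over ANY field: with `L` the polynomials of degree
`≤ (n-1)/2` and `M = [MAJ = 1]`, every function `v` is `q₁ + M q₂` with `q₁, q₂ ∈ L` — take `q₁`
agreeing with `v` on the lower half and `q₂` agreeing with `v - q₁` on the upper half. This is the
mechanism behind MAJORITY ∉ AC⁰[p] for all `p`. [folklore] -/
theorem ispace_majorityFn_eq_top (hn : Odd n) : ispace F (majorityFn n) = ⊤ := by
  obtain ⟨m, hm⟩ := hn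
  have hdiv : n / 2 = m := by omega
  refine Submodule.eq_top_iff'.2 fun v => ?_
  obtain ⟨q₁, hq₁, hv₁⟩ := exists_lowDeg_eq_on_lower (F := F) m v
  obtain ⟨q₂, hq₂, hv₂⟩ := exists_lowDeg_eq_on_upper (F := F) hm (v - q₁)
  have hdec : v = (LinearMap.mulLeft F (indOf F (majorityFn n))) q₂ + q₁ := by
    funext b
    rw [Pi.add_apply, LinearMap.mulLeft_apply, Pi.mul_apply, indOf_apply]
    simp only [majorityFn, decide_eq_true_eq]
    by_cases hb : n ≤ 2 * GateFn.numOnes b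
    · rw [if_pos hb, one_mul, hv₂ b (by omega), Pi.sub_apply, sub_add_cancel]
    · rw [if_neg hb, zero_mul, zero_add, hv₁ b (by omega)]
  rw [hdec, ispace, hdiv]
  exact Submodule.add_mem_sup (Submodule.mem_map_of_mem hq₂) hq₁

/-- **`dim L ≥ 2ⁿ⁻¹` in every characteristic** (odd `n`), in the form `2ⁿ ≤ 2 · dim L`: from
`L + MAJ·L = ⊤` and `dim (MAJ·L) ≤ dim L`. (`two_pow_le_two_mul_finrank_lowDeg` of
`SmolenskyProperty.lean` needs `2 ≠ 0`.) [folklore] -/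
theorem two_pow_le_two_mul_finrank_lowDeg' (hn : Odd n) :
    2 ^ n ≤ 2 * Module.finrank F (lowDeg F n (n / 2)) := by
  have htop := ispace_majorityFn_eq_top (F := F) hn
  rw [ispace] at htop
  have h := Submodule.finrank_add_le_finrank_add_finrank
    ((lowDeg F n (n / 2)).map (LinearMap.mulLeft F (indOf F (majorityFn n)))) (lowDeg F n (n / 2))
  rw [htop, finrank_top, finrank_cubeFn] at h
  have hmap := Submodule.finrank_map_le (LinearMap.mulLeft F (indOf F (majorityFn n)))
    (lowDeg F n (n / 2))
  omega

/-- **MAJORITY has the property, maximally**: `dim(ML + L) = 2ⁿ` for odd `n`, over any field.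
[folklore] -/
theorem majorityFn_mem_iproperty (hn : Odd n) : majorityFn n ∈ iproperty F n := by
  rw [mem_iproperty_iff, ispace_majorityFn_eq_top hn, finrank_top, finrank_cubeFn]
  omega

/-! ### Largeness in characteristic `2`: the pairing `h ↦ h ⊕ MAJ` -/

/-- The majority flip `h ⊕ MAJ` of a Boolean function. [folklore] -/
def majFlip (h : (Fin n → Bool) → Bool) : (Fin n → Bool) → Bool :=
  fun b => xor (h b) (majorityFn n b)

/-- The majority flip is an involution. [folklore] -/
theorem majFlip_majFlip (h : (Fin n → Bool) → Bool) : majFlip (majFlip h) = h := by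
  funext b
  simp [majFlip]

/-- In characteristic `2`, `[h ⊕ MAJ] = [h] + [MAJ]`. [folklore] -/
theorem indOf_majFlip (h2 : (2 : F) = 0) (h : (Fin n → Bool) → Bool) :
    indOf F (majFlip h) = indOf F h + indOf F (majorityFn n) := by
  funext b
  simp only [indOf_apply, majFlip, Pi.add_apply]
  have h11 : (1 : F) + 1 = 0 := by rw [← two_mul, mul_one]; exact h2
  rcases Bool.eq_false_or_eq_true (h b) with hb | hb <;>
    rcases Bool.eq_false_or_eq_true (majorityFn n b) with hm | hm <;> simp [hb, hm, h11]

/-- **The pairing inequality in characteristic `2`**: for odd `n`, every Boolean `h` satisfies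
`dim([h]L + L) + dim([h ⊕ MAJ]L + L) ≥ (3/2)·2ⁿ`. Proof: with `A, B` the two spaces,
`A + B ⊇ ML + L = ⊤` (`M = [h ⊕ MAJ] - [h]`) and `A ∩ B ⊇ L`, `dim L ≥ 2ⁿ⁻¹`. [folklore] -/
theorem three_mul_two_pow_le_of_two_eq_zero (hn : Odd n) (h2 : (2 : F) = 0)
    (h : (Fin n → Bool) → Bool) :
    3 * 2 ^ n ≤ 2 * (Module.finrank F (ispace F h) + Module.finrank F (ispace F (majFlip h))) := by
  -- `A + B = ⊤`
  have hsup : ispace F h ⊔ ispace F (majFlip h) = ⊤ := by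
    refine top_le_iff.1 ?_
    rw [← ispace_majorityFn_eq_top (F := F) hn, ispace]
    refine sup_le ?_ (le_sup_of_le_left (by unfold ispace; exact le_sup_right))
    intro x hx
    obtain ⟨q, hq, rfl⟩ := Submodule.mem_map.1 hx
    have hrw : (LinearMap.mulLeft F (indOf F (majorityFn n))) q =
        (LinearMap.mulLeft F (indOf F (majFlip h))) q - (LinearMap.mulLeft F (indOf F h)) q := by
      simp only [LinearMap.mulLeft_apply, indOf_majFlip h2, add_mul, add_sub_cancel_left]
    rw [hrw]
    refine Submodule.sub_mem _ (Submodule.mem_sup_right ?_) (Submodule.mem_sup_left ?_)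
    · unfold ispace
      exact Submodule.mem_sup_left (Submodule.mem_map_of_mem hq)
    · unfold ispace
      exact Submodule.mem_sup_left (Submodule.mem_map_of_mem hq)
  -- `A ∩ B ⊇ L`
  have hinf : lowDeg F n (n / 2) ≤ ispace F h ⊓ ispace F (majFlip h) :=
    le_inf (by unfold ispace; exact le_sup_right) (by unfold ispace; exact le_sup_right)
  have hkey := Submodule.finrank_sup_add_finrank_inf_eq (ispace F h) (ispace F (majFlip h))
  rw [hsup, finrank_top, finrank_cubeFn] at hkey
  have hmono := Submodule.finrank_mono hinf
  have hLdim := two_pow_le_two_mul_finrank_lowDeg' (F := F) hn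
  omega

/-- **Largeness in characteristic `2`**: for odd `n`, at least half of all Boolean functions
`h : {0,1}ⁿ → {0,1}` satisfy `dim([h]L + L) ≥ (3/4)2ⁿ`, i.e. `2^(2^n) ≤ 2 · |iproperty F n|`.
[folklore] -/
theorem two_pow_le_two_mul_card_iproperty_of_two_eq_zero (hn : Odd n) (h2 : (2 : F) = 0) :
    2 ^ (2 ^ n) ≤ 2 * Nat.card (iproperty F n) := by
  classical
  set good : Finset ((Fin n → Bool) → Bool) := univ.filter fun h => h ∈ iproperty F n with hgood
  have hcard : Nat.card (iproperty F n) = good.card := by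
    rw [Nat.card_eq_fintype_card, ← Set.toFinset_card]
    congr 1
    ext h
    simp [hgood]
  have hcover : (univ : Finset ((Fin n → Bool) → Bool)) ⊆ good ∪ good.image majFlip := by
    intro h _
    rcases le_or_gt (3 * 2 ^ n) (4 * Module.finrank F (ispace F h)) with hh | hh
    · exact Finset.mem_union_left _ (by simp [hgood, mem_iproperty_iff, hh])
    · have hflip : 3 * 2 ^ n ≤ 4 * Module.finrank F (ispace F (majFlip h)) := by
        have := three_mul_two_pow_le_of_two_eq_zero (F := F) hn h2 h
        omega
      refine Finset.mem_union_right _ (Finset.mem_image.2 ⟨majFlip h, ?_, ?_⟩)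
      · simp [hgood, mem_iproperty_iff, hflip]
      · exact majFlip_majFlip h
  have huniv : (univ : Finset ((Fin n → Bool) → Bool)).card = 2 ^ (2 ^ n) := by
    simp
  calc 2 ^ (2 ^ n) = (univ : Finset ((Fin n → Bool) → Bool)).card := huniv.symm
    _ ≤ (good ∪ good.image majFlip).card := Finset.card_le_card hcover
    _ ≤ good.card + (good.image majFlip).card := Finset.card_union_le _ _
    _ ≤ good.card + good.card := Nat.add_le_add_left Finset.card_image_le _
    _ = 2 * Nat.card (iproperty F n) := by rw [hcard]; ring

/-- **Largeness of the `0/1` property over every field** (CIKK Thm. 5.3, "largeness at least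
`1/2`", now including `GF(2)`): for odd `n`, `2^(2^n) ≤ 2 · |iproperty F n|` — by the majority
pairing in characteristic `2` and by the parity pairing of `SmolenskyProperty.lean` otherwise.
[cite: CarmosinoImpagliazzoKabanetsKolokolova2016, Thm. 5.3] -/
theorem two_pow_le_two_mul_card_iproperty (hn : Odd n) :
    2 ^ (2 ^ n) ≤ 2 * Nat.card (iproperty F n) := by
  by_cases h2 : (2 : F) = 0
  · exact two_pow_le_two_mul_card_iproperty_of_two_eq_zero hn h2
  · rw [iproperty_eq_property h2]
    exact two_pow_le_two_mul_card_property hn h2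

/-! ### The dimension bound and usefulness for the `0/1` version -/

/-- **Smolensky's dimension bound, `0/1` version**: if `[h]` agrees outside `E` with a polynomial
function `P` of degree `≤ D`, then `[h]L + L ⊆ lowDeg (n/2 + D) + F^E`, whence
`dim([h]L + L) ≤ Σ_{i ≤ n/2 + D} C(n,i) + |E|`. [cite: Smolensky1987, Thm. 1 (proof, p. 80)] -/
theorem finrank_ispace_le (h : (Fin n → Bool) → Bool) {D : ℕ} {P : CubeFn F n}
    (hP : P ∈ lowDeg F n D) (E : Finset (Fin n → Bool)) (hE : ∀ b, b ∉ E → indOf F h b = P b) :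
    Module.finrank F (ispace F h) ≤ (∑ i ∈ range (n / 2 + D + 1), n.choose i) + E.card := by
  classical
  have hle : ispace F h ≤ lowDeg F n (n / 2 + D) ⊔ suppOn F E := by
    refine sup_le ?_ (le_sup_of_le_left (lowDeg_mono (Nat.le_add_right _ _)))
    rw [lowDeg_eq_span (D := n / 2), Submodule.map_span_le]
    rintro _ ⟨⟨S, hS⟩, rfl⟩
    dsimp only
    rw [LinearMap.mulLeft_apply]
    have hsplit : indOf F h * mono F S = P * mono F S + (indOf F h - P) * mono F S := by
      rw [sub_mul, add_sub_cancel]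
    rw [hsplit]
    refine Submodule.add_mem _ (Submodule.mem_sup_left ?_) (Submodule.mem_sup_right ?_)
    · have := mul_mem_lowDeg_add hP (mono_mem_lowDeg (F := F) hS)
      rwa [Nat.add_comm] at this
    · refine mem_suppOn_of_forall fun b hb => ?_
      rw [Pi.mul_apply, Pi.sub_apply, hE b hb, sub_self, zero_mul]
  refine (Submodule.finrank_mono hle).trans ?_
  refine (Submodule.finrank_add_le_finrank_add_finrank _ _).trans ?_
  exact Nat.add_le_add (finrank_lowDeg_le _) (finrank_suppOn_le E)

/-- **Usefulness criterion, `0/1` version** (exact form): for odd `n`, if `[h]` agrees outside `E`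
with a polynomial function of degree `≤ D` and `4 · (D · C(n, n/2) + |E|) < 2ⁿ`, then
`dim([h]L + L) < (3/4)2ⁿ`. [cite: CarmosinoImpagliazzoKabanetsKolokolova2016, Thm. 5.3] -/
theorem not_mem_iproperty (hn : Odd n) (h : (Fin n → Bool) → Bool) {D : ℕ} {P : CubeFn F n}
    (hP : P ∈ lowDeg F n D) (E : Finset (Fin n → Bool)) (hE : ∀ b, b ∉ E → indOf F h b = P b)
    (hlt : 4 * (D * n.choose (n / 2) + E.card) < 2 ^ n) : h ∉ iproperty F n := by
  rw [mem_iproperty_iff, not_le]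
  have h1 := finrank_ispace_le h hP E hE
  have h2 := sum_range_choose_le hn D
  have h3 : 2 ^ n = 2 * 2 ^ (n - 1) := by
    obtain ⟨m, rfl⟩ := hn
    rw [show 2 * m + 1 - 1 = 2 * m by omega, pow_succ]
    ring
  omega

variable {p : ℕ} [Fact p.Prime]

/-- **Usefulness of the `0/1` property against `AC⁰[p]`, every prime `p` (including `2`)**, exact
form: for odd `n`, a circuit `C` over `accBasis p` of `acDepth ≤ d` computing `h`, and `ℓ ≥ 1`
with `4 · ((p-1)ℓ)^d · C(n,n/2) · p^ℓ + 4 · size(C) · 2ⁿ < 2ⁿ · p^ℓ`, the function `h` does not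
have the property `dim([h]L + L) ≥ (3/4)2ⁿ` over `𝔽_p` (Razborov–Smolensky approximation of
degree `((p-1)ℓ)^d` off a set `E` with `|E| p^ℓ ≤ size · 2ⁿ`, then the dimension bound).
[cite: CarmosinoImpagliazzoKabanetsKolokolova2016, Thm. 5.3] -/
theorem not_mem_iproperty_of_computes (hn : Odd n) {d : ℕ} (C : Circuit (Fin n))
    (hC : C.IsOver (accBasis p)) (hd : C.acDepth ≤ d) {h : (Fin n → Bool) → Bool}
    (hh : C.Computes h) {ℓ : ℕ} (hℓ : 1 ≤ ℓ)
    (hlt : 4 * ((p - 1) * ℓ) ^ d * n.choose (n / 2) * p ^ ℓ + 4 * C.size * 2 ^ n < 2 ^ n * p ^ ℓ) :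
    h ∉ iproperty (ZMod p) n := by
  have hp := (Fact.out : p.Prime)
  have hM1 : 1 ≤ (p - 1) * ℓ := Nat.mul_pos (by have := hp.two_le; omega) hℓ
  obtain ⟨P, E, hP, hE, hPE⟩ := razborov_smolensky C hC hℓ
  have hP' : P ∈ lowDeg (ZMod p) n (((p - 1) * ℓ) ^ d) :=
    lowDeg_mono (Nat.pow_le_pow_right hM1 hd) hP
  refine not_mem_iproperty hn h hP' E ?_ ?_
  · intro b hb
    rw [hPE b hb, hh b]
    simp only [indOf_apply, bit]
  · have hppos : 0 < p ^ ℓ := pow_pos hp.pos ℓ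
    refine Nat.lt_of_mul_lt_mul_right (a := p ^ ℓ) ?_
    calc 4 * (((p - 1) * ℓ) ^ d * n.choose (n / 2) + E.card) * p ^ ℓ
        = 4 * ((p - 1) * ℓ) ^ d * n.choose (n / 2) * p ^ ℓ + 4 * (E.card * p ^ ℓ) := by ring
      _ ≤ 4 * ((p - 1) * ℓ) ^ d * n.choose (n / 2) * p ^ ℓ + 4 * (C.size * 2 ^ n) :=
          Nat.add_le_add_left (Nat.mul_le_mul_left 4 hE) _
      _ = 4 * ((p - 1) * ℓ) ^ d * n.choose (n / 2) * p ^ ℓ + 4 * C.size * 2 ^ n := by ring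
      _ < 2 ^ n * p ^ ℓ := hlt

/-! ### MAJORITY ∉ AC⁰[p] -/

/-- **MAJORITY ∉ AC⁰[p], for every prime `p`, quantitatively** (Razborov 1987 for `p = 2`;
Smolensky 1987, Thm. 2 and its Corollary, for all `p`; Jukna 2012, Thm. 12.24). Let `p` be a
prime, `n` odd, and `C` a circuit over `accBasis p = {¬, ∧ₖ, ∨ₖ, MOD_{p,k}}` of `acDepth ≤ d`
computing the majority of `n` bits. Then for every `ℓ ≥ 1` with `64 · ((p-1)ℓ)^{2d} ≤ n` one has
`p^ℓ ≤ 8 · size(C)`; taking the largest such `ℓ`, the size is `2^{Ω(n^{1/(2d)})}`. (MAJORITY has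
the property `dim(ML + L) = 2ⁿ`, while the usefulness inequality would deny it.)
[cite: Smolensky1987, Thm. 2 and Corollary; Razborov1987; Jukna2012, Thm. 12.24] -/
theorem smolensky_majority (hn : Odd n) {d : ℕ} (C : Circuit (Fin n))
    (hC : C.IsOver (accBasis p)) (hd : C.acDepth ≤ d) (hmaj : C.Computes (majorityFn n)) {ℓ : ℕ}
    (hℓ : 1 ≤ ℓ) (hℓn : 64 * ((p - 1) * ℓ) ^ (2 * d) ≤ n) : p ^ ℓ ≤ 8 * C.size := by
  have hmem := majorityFn_mem_iproperty (F := ZMod p) hn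
  -- the usefulness inequality must therefore FAIL
  have hfail : 2 ^ n * p ^ ℓ ≤
      4 * ((p - 1) * ℓ) ^ d * n.choose (n / 2) * p ^ ℓ + 4 * C.size * 2 ^ n := by
    by_contra hlt
    exact not_mem_iproperty_of_computes hn C hC hd hmaj hℓ (not_le.1 hlt) hmem
  -- `8 D C(n,n/2) ≤ 2ⁿ` from `64 D² ≤ n` and `C(n,n/2)² n ≤ 4ⁿ`
  have hDC : 8 * (((p - 1) * ℓ) ^ d * n.choose (n / 2)) ≤ 2 ^ n := by
    have hsq : (8 * (((p - 1) * ℓ) ^ d * n.choose (n / 2))) ^ 2 ≤ (2 ^ n) ^ 2 := by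
      calc (8 * (((p - 1) * ℓ) ^ d * n.choose (n / 2))) ^ 2
          = 64 * ((p - 1) * ℓ) ^ (2 * d) * n.choose (n / 2) ^ 2 := by ring
        _ ≤ n * n.choose (n / 2) ^ 2 := Nat.mul_le_mul_right _ hℓn
        _ = n.choose (n / 2) ^ 2 * n := by ring
        _ ≤ 4 ^ n := choose_half_sq_mul_le hn
        _ = (2 ^ n) ^ 2 := by rw [← pow_mul, mul_comm, pow_mul]; norm_num
    exact (Nat.pow_le_pow_iff_left two_ne_zero).1 hsq
  have h1 : 8 * (((p - 1) * ℓ) ^ d * n.choose (n / 2)) * p ^ ℓ ≤ 2 ^ n * p ^ ℓ :=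
    Nat.mul_le_mul_right _ hDC
  have h2 : 2 * (2 ^ n * p ^ ℓ) ≤ 2 ^ n * p ^ ℓ + 2 ^ n * (8 * C.size) := by
    calc 2 * (2 ^ n * p ^ ℓ)
        ≤ 2 * (4 * ((p - 1) * ℓ) ^ d * n.choose (n / 2) * p ^ ℓ + 4 * C.size * 2 ^ n) :=
          Nat.mul_le_mul_left 2 hfail
      _ = 8 * (((p - 1) * ℓ) ^ d * n.choose (n / 2)) * p ^ ℓ + 2 ^ n * (8 * C.size) := by ring
      _ ≤ 2 ^ n * p ^ ℓ + 2 ^ n * (8 * C.size) := Nat.add_le_add_right h1 _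
  have hfin : 2 ^ n * p ^ ℓ ≤ 2 ^ n * (8 * C.size) := by omega
  exact Nat.le_of_mul_le_mul_left hfin (pow_pos two_pos n)

end Smolensky

end Literature.Computability.MetaComplexity
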